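import Summits.QuantumAdvantage.QuantumAdvantage.Theorems.CertDialB
import Summits.QuantumAdvantage.AdviceFreeQNC0.RingRotation
import HarnessLib

/-!
# CertDial (C) — decomp-qadv lens-2 (structural dichotomy: special vs generic), generation 28, part 3/3

Part 3/3 of NODE «CertDial» (memo in part A's header and `NODE-g28.md`): §3d COROLLARY B′ — rotating the free arc (tree `RingRotation.rel_rot`,
`Smolensky.comp_mem_lowDeg_of_coord`) and a pigeonhole free arc give `no_bounded_universal_family` (for `n ≥ (M·w+1)(2M+1)` ANY `M` odd-class
inputs of weight `≤ w` are won simultaneously by one degree-`≤ D` strategy, `D ≥ 1`); §4 the node — `GenericLightFail D w := PGlobalFail 2 D w ∧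
OGlobalFail 2 D w`, weight/degree monotonicity, `lightFail_iff_generic'` (every `w ≥ 7`), the ∃-weight residual `GenericLightFailSome` with
`closes_some`, `closes : GenericLightFail 2 7 → NoPerfectTwo3` BY NAME (= tree `ParityDial.closes₃`), the necessary AFFINE rung `AffineLightFail`;
§5 `no_xor_certificate`.  Nothing here proves or refutes `PGlobalFail 2 2 7` / `OGlobalFail 2 2 7` / 27432.  `lean check` (own closure) rc 0 ·
0 sorry · 0 warning; axioms standard.
-/

set_option linter.dupNamespace false
set_option linter.style.longLine false

noncomputable section
open scoped Classical

namespace Summit.QuantumAdvantage.QuantumAdvantage.Theorems.CertDial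
open Finset
open Literature.Computability.QuantumComplexity Literature.Computability.QuantumComplexity.RingHLF
open Summit.QuantumAdvantage.AdviceFreeQNC0
open Literature.Computability.MetaComplexity Literature.Computability.MetaComplexity.Smolensky
open Summit.QuantumAdvantage.QuantumAdvantage.Theorems.RingPeriodFold
  (kvec kernel_pair_of_oddZeros kvec_ne_zero rel_iff_of_kernel_pair)
open Summit.QuantumAdvantage.QuantumAdvantage.Theorems.LightDial (wt lightLosing LightFail mono_singleton_apply)
open Summit.QuantumAdvantage.QuantumAdvantage.Theorems.ParityDial (PGlobalFail OGlobalFail PLocalFail IsParityLocal)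
open Summit.QuantumAdvantage.QuantumAdvantage.Theses.ExactnessDial (NoPerfectTwo3)

variable {n : ℕ}

/-! ### §3d Rotating the arc: NO BOUNDED UNIVERSAL FAMILY for the degree-`≥ 1` classes -/

open Summit.QuantumAdvantage.AdviceFreeQNC0.RingSymmetry (shift rot_apply rel_rot card_filter_shift shift_shift)
open Summit.QuantumAdvantage.QuantumAdvantage.Theorems.RingPeriodFold (ind_rot_mem')

/-- the inverse shift. -/
theorem shift_unshift (hn : 0 < n) (a : ℕ) (b : Fin n) : shift n (n - a % n) (shift n a b) = b := by
  rw [shift_shift]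
  apply Fin.ext
  simp only [shift]
  have ha : a % n < n := Nat.mod_lt _ hn
  have : (a + (n - a % n)) % n = 0 := by
    rw [show a + (n - a % n) = n * (a / n + 1) by have := Nat.div_add_mod a n; rw [Nat.mul_add, Nat.mul_one]; omega]
    exact Nat.mul_mod_right n _
  rw [Nat.add_mod, this, Nat.add_zero, Nat.mod_mod, Nat.mod_eq_of_lt b.isLt]

/-- conjugating a strategy by a rotation: `(conjStrat a P') (shift a b) x = P' b (rot a x)`. -/
def conjStrat (a : ℕ) (P' : Fin n → CubeFn (ZMod 3) n) : Fin n → CubeFn (ZMod 3) n :=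
  fun c x => P' (shift n (n - a % n) c) (rot a x)

/-- the conjugated strategy at a shifted position. -/
theorem conjStrat_shift (hn : 0 < n) (a : ℕ) (P' : Fin n → CubeFn (ZMod 3) n) (b : Fin n) (x : Fin n → Bool) :
    conjStrat a P' (shift n a b) x = P' b (rot a x) := by
  simp [conjStrat, shift_unshift hn]

/-- conjugation by a rotation preserves the degree bound (tree `Smolensky.comp_mem_lowDeg_of_coord`). -/
theorem conjStrat_mem {D : ℕ} (a : ℕ) {P' : Fin n → CubeFn (ZMod 3) n} (hP' : ∀ i, P' i ∈ lowDeg (ZMod 3) n D) (c : Fin n) :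
    conjStrat a P' c ∈ lowDeg (ZMod 3) n D :=
  Smolensky.comp_mem_lowDeg_of_coord (rot a) (ind_rot_mem' a) (hP' _)

/-- the answer of the conjugated strategy is the rotated answer. -/
theorem ans_conjStrat (hn : 0 < n) (a : ℕ) (P' : Fin n → CubeFn (ZMod 3) n) (x : Fin n → Bool) :
    rot a (ans (conjStrat a P') x) = ans P' (rot a x) := by
  funext b
  rw [rot_apply]
  simp [ans, conjStrat_shift hn]

/-- SPARSE REPAIR ON ANY ARC: a family of odd-class inputs vanishing on the arc `{a, …, a+L-1}` (cyclically), `L ≥ 2|𝒳| + 1`, is won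
simultaneously by one strategy of degree `≤ D` (`D ≥ 1`). -/
theorem sparse_family_winnable_arc (hn : 3 ≤ n) {D : ℕ} (hD : 1 ≤ D) (a : ℕ) {L : ℕ} (hL : L ≤ n)
    (𝒳 : Finset (Fin n → Bool)) (hodd : ∀ x ∈ 𝒳, OddZeros x)
    (hoff : ∀ x ∈ 𝒳, ∀ b : Fin n, (b : ℕ) < L → x (shift n a b) = false) (hcard : 2 * 𝒳.card + 1 ≤ L) :
    ∃ P : Fin n → CubeFn (ZMod 3) n, (∀ i, P i ∈ lowDeg (ZMod 3) n D) ∧ ∀ x ∈ 𝒳, Rel x (ans P x) := by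
  have hn0 : 0 < n := by omega
  -- rotate the family so that the free arc starts at `0`
  let 𝒴 : Finset (Fin n → Bool) := 𝒳.image (rot a)
  have hY : ∀ y ∈ 𝒴, ∃ x ∈ 𝒳, y = rot a x := fun y hy => by
    obtain ⟨x, hx, rfl⟩ := Finset.mem_image.1 hy; exact ⟨x, hx, rfl⟩
  have hoddY : ∀ y ∈ 𝒴, OddZeros y := fun y hy => by
    obtain ⟨x, hx, rfl⟩ := hY y hy
    -- the odd class is rotation invariant (tree `RingDeck.oddZeros_rot`, outside this import cone; three lines re-derived)
    have h := hodd x hx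
    unfold OddZeros at h ⊢
    rwa [show (univ.filter fun b : Fin n => rot a x b = false) = univ.filter fun b : Fin n => x (shift n a b) = false from rfl,
      card_filter_shift a (fun b : Fin n => x b = false)]
  have hoffY : ∀ y ∈ 𝒴, ∀ b : Fin n, (b : ℕ) < L → y b = false := fun y hy b hb => by
    obtain ⟨x, hx, rfl⟩ := hY y hy; rw [rot_apply]; exact hoff x hx b hb
  have hYc : 𝒴.card ≤ 𝒳.card := Finset.card_image_le
  have hcardY : 2 * 𝒴.card + 1 ≤ L := by omega
  obtain ⟨P', hP', hwin⟩ := sparse_family_not_universal hn hD hL 𝒴 hoddY hoffY hcardY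
  refine ⟨conjStrat a P', conjStrat_mem a hP', fun x hx => ?_⟩
  have h := hwin (rot a x) (Finset.mem_image_of_mem _ hx)
  rw [← ans_conjStrat hn0 a P' x, rel_rot] at h
  exact h

/-- pigeonhole: `M` inputs of weight `≤ w` on a cycle of length `n ≥ (M·w + 1)·L` leave an arc `{a, …, a+L-1}` free. -/
theorem exists_free_arc {M w L : ℕ} (hL : 0 < L) (hn : (M * w + 1) * L ≤ n) (𝒳 : Finset (Fin n → Bool))
    (hM : 𝒳.card ≤ M) (hw : ∀ x ∈ 𝒳, LightDial.wt x ≤ w) :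
    ∃ a : ℕ, a + L ≤ n ∧ ∀ x ∈ 𝒳, ∀ b : Fin n, (b : ℕ) < L → x (shift n a b) = false := by
  -- the marked positions and the blocks they hit
  let U : Finset (Fin n) := 𝒳.biUnion fun x => univ.filter fun i : Fin n => x i = true
  have hU : U.card ≤ M * w := by
    refine (Finset.card_biUnion_le).trans ?_
    refine (Finset.sum_le_card_nsmul _ _ w fun x hx => hw x hx).trans ?_
    rw [smul_eq_mul]
    exact Nat.mul_le_mul_right _ hM
  let B : Finset ℕ := U.image fun i : Fin n => (i : ℕ) / L
  have hB : B.card ≤ M * w := Finset.card_image_le.trans hU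
  -- a block index `j₀ ≤ M·w` that is not hit
  obtain ⟨j₀, hj₀, hjB⟩ : ∃ j₀ ∈ Finset.range (M * w + 1), j₀ ∉ B := by
    by_contra h
    push Not at h
    have : (Finset.range (M * w + 1)).card ≤ B.card := Finset.card_le_card fun j hj => h j hj
    rw [Finset.card_range] at this
    omega
  have hj₀' : j₀ ≤ M * w := by simpa [Finset.mem_range, Nat.lt_succ_iff] using hj₀
  refine ⟨j₀ * L, ?_, fun x hx b hb => ?_⟩
  · calc j₀ * L + L = (j₀ + 1) * L := by ring
      _ ≤ (M * w + 1) * L := Nat.mul_le_mul_right _ (by omega)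
      _ ≤ n := hn
  · -- the position `b + j₀ L` lies in block `j₀`, hence is unmarked
    have hlt : (b : ℕ) + j₀ * L < n := by
      calc (b : ℕ) + j₀ * L < L + j₀ * L := by omega
        _ = (j₀ + 1) * L := by ring
        _ ≤ (M * w + 1) * L := Nat.mul_le_mul_right _ (by omega)
        _ ≤ n := hn
    have hval : ((shift n (j₀ * L) b : Fin n) : ℕ) = (b : ℕ) + j₀ * L := by
      simp [shift, Nat.mod_eq_of_lt hlt]
    have hblk : ((shift n (j₀ * L) b : Fin n) : ℕ) / L = j₀ := by
      rw [hval, Nat.add_mul_div_right _ _ hL, Nat.div_eq_of_lt hb, Nat.zero_add]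
    by_contra hne
    have htrue : x (shift n (j₀ * L) b) = true := by simpa using hne
    refine hjB (Finset.mem_image.2 ⟨shift n (j₀ * L) b, ?_, hblk⟩)
    exact Finset.mem_biUnion.2 ⟨x, hx, by simpa using htrue⟩

/-- ★★ COROLLARY B′ (NO BOUNDED UNIVERSAL FAMILY — contrast g26–g27, where ONE light input defeats every window / parity-local / comb-local
rule): for every `M`, `w` and every length `n ≥ (M·w + 1)·(2M + 1)` (`n ≥ 3`), ANY `M` odd-class inputs of weight `≤ w` are won
SIMULTANEOUSLY by a single strategy of degree `≤ D`, for every `D ≥ 1` (indeed by an affine one).  So no proof of `PGlobalFail`,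
`OGlobalFail`, `AffineLightFail` — at any weight — can proceed by a bounded family of test inputs per length. -/
theorem no_bounded_universal_family (M w : ℕ) {n : ℕ} (hn : 3 ≤ n) (hn' : (M * w + 1) * (2 * M + 1) ≤ n) {D : ℕ} (hD : 1 ≤ D)
    (𝒳 : Finset (Fin n → Bool)) (hM : 𝒳.card ≤ M) (hX : ∀ x ∈ 𝒳, OddZeros x ∧ LightDial.wt x ≤ w) :
    ∃ P : Fin n → CubeFn (ZMod 3) n, (∀ i, P i ∈ lowDeg (ZMod 3) n D) ∧ ∀ x ∈ 𝒳, Rel x (ans P x) := by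
  obtain ⟨a, haL, hfree⟩ := exists_free_arc (L := 2 * M + 1) (by omega) hn' 𝒳 hM fun x hx => (hX x hx).2
  exact sparse_family_winnable_arc hn hD a (by omega) 𝒳 (fun x hx => (hX x hx).1) hfree (by omega)

/-! ## §4 The node: the generic light law by weight, the ∃-weight residual, the necessary AFFINE rung, `closes` BY NAME -/

open Summit.QuantumAdvantage.QuantumAdvantage.Theorems.ParityDial
  (LightFailOdd OffsetCombFail IsOffsetCombLocal pLocalFail_two_seven pLocalFail_mono offsetCombFail_six offsetCombFail_mono
   lightFail_of_pieces pieces_of_lightFail lightFailOdd_of_pieces opieces_of_lightFailOdd lightFail_iff_generic_two closes₃)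

/-- THE GENERIC LIGHT LAW at degree `D`, weight `w` (both parities of the length; radius-2 special classes removed):
the conjunction of g27's generic leaves. -/
def GenericLightFail (D w : ℕ) : Prop := PGlobalFail 2 D w ∧ OGlobalFail 2 D w

/-- the ∃-WEIGHT RESIDUAL (strictly weaker law-bet): SOME fixed weight defeats every generic degree-`≤ D` strategy, eventually in `n`. -/
def GenericLightFailSome (D : ℕ) : Prop := ∃ w, GenericLightFail D w

/-- monotonicity of the even generic piece in the weight. -/
theorem pGlobalFail_mono_weight {r D w w' : ℕ} (hw : w ≤ w') (h : PGlobalFail r D w) : PGlobalFail r D w' := by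
  obtain ⟨n₀, h₀⟩ := h
  refine ⟨n₀, fun n hn he P hP hl => ?_⟩
  obtain ⟨x, hx, hxw, hR⟩ := h₀ n hn he P hP hl
  exact ⟨x, hx, hxw.trans hw, hR⟩

/-- monotonicity of the odd generic piece in the weight. -/
theorem oGlobalFail_mono_weight {r D w w' : ℕ} (hw : w ≤ w') (h : OGlobalFail r D w) : OGlobalFail r D w' := by
  obtain ⟨n₀, h₀⟩ := h
  refine ⟨n₀, fun n hn ho P hP hl => ?_⟩
  obtain ⟨x, hx, hxw, hR⟩ := h₀ n hn ho P hP hl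
  exact ⟨x, hx, hxw.trans hw, hR⟩

/-- antitonicity of the even generic piece in the degree (fewer strategies to defeat). -/
theorem pGlobalFail_anti_degree {r D D' w : ℕ} (hD : D ≤ D') (h : PGlobalFail r D' w) : PGlobalFail r D w := by
  obtain ⟨n₀, h₀⟩ := h
  exact ⟨n₀, fun n hn he P hP hl => h₀ n hn he P (fun i => lowDeg_mono hD (hP i)) hl⟩

/-- antitonicity of the odd generic piece in the degree. -/
theorem oGlobalFail_anti_degree {r D D' w : ℕ} (hD : D ≤ D') (h : OGlobalFail r D' w) : OGlobalFail r D w := by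
  obtain ⟨n₀, h₀⟩ := h
  exact ⟨n₀, fun n hn ho P hP hl => h₀ n hn ho P (fun i => lowDeg_mono hD (hP i)) hl⟩

/-- the generic light law is monotone in the weight. -/
theorem genericLightFail_mono_weight {D w w' : ℕ} (hw : w ≤ w') (h : GenericLightFail D w) : GenericLightFail D w' :=
  ⟨pGlobalFail_mono_weight hw h.1, oGlobalFail_mono_weight hw h.2⟩

/-- the generic light law is antitone in the degree. -/
theorem genericLightFail_anti_degree {D D' w : ℕ} (hD : D ≤ D') (h : GenericLightFail D' w) : GenericLightFail D w :=
  ⟨pGlobalFail_anti_degree hD h.1, oGlobalFail_anti_degree hD h.2⟩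

/-- GLUING at every weight `w ≥ 7` (the special pieces are theorems at weight 7: `pLocalFail_two_seven`, `offsetCombFail_six`). -/
theorem lightFail_of_generic {D w : ℕ} (hw : 7 ≤ w) (h : GenericLightFail D w) : LightFail D w :=
  lightFail_of_pieces (pLocalFail_mono hw pLocalFail_two_seven) h.1
    (lightFailOdd_of_pieces (offsetCombFail_mono (show 6 ≤ w by omega) (offsetCombFail_six 2)) h.2)

/-- EXACTNESS (every weight): the light dial statement gives back both generic pieces. -/
theorem generic_of_lightFail {D w : ℕ} (h : LightFail D w) : GenericLightFail D w :=
  ⟨(pieces_of_lightFail h).1, opieces_of_lightFailOdd (pieces_of_lightFail (r := 2) h).2⟩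

/-- ★ NODE EQUATION at every weight `w ≥ 7`: `LightFail D w ⟺ GenericLightFail D w` (g27's radius-2 node is the case `w = 7`). -/
theorem lightFail_iff_generic' {D w : ℕ} (hw : 7 ≤ w) : LightFail D w ↔ GenericLightFail D w :=
  ⟨generic_of_lightFail, lightFail_of_generic hw⟩

/-- the ∃-weight residual is exactly `∃ w, LightFail D w`. -/
theorem genericLightFailSome_iff (D : ℕ) : GenericLightFailSome D ↔ ∃ w, LightFail D w := by
  constructor
  · rintro ⟨w, h⟩
    exact ⟨max w 7, lightFail_of_generic (le_max_right _ _) (genericLightFail_mono_weight (le_max_left _ _) h)⟩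
  · rintro ⟨w, h⟩
    exact ⟨w, generic_of_lightFail h⟩

/-- the weight-7 leaf implies the ∃-weight residual (the residual is WEAKER; the converse is not claimed). -/
theorem genericLightFailSome_of_seven {D : ℕ} (h : GenericLightFail D 7) : GenericLightFailSome D := ⟨7, h⟩

/-- ★ `closes`: g27's radius-2 generic pieces at weight 7 give ExactnessDial's `NoPerfectTwo3` (stmt-QuantumAdvantage-27432) BY NAME. -/
theorem closes (h : GenericLightFail 2 7) : NoPerfectTwo3 := closes₃ h.1 h.2

/-- ★ `closes_some`: so does the ∃-weight residual (through `LightDial.closes w`). -/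
theorem closes_some (h : GenericLightFailSome 2) : NoPerfectTwo3 := by
  obtain ⟨w, hw⟩ := (genericLightFailSome_iff 2).mp h
  exact LightDial.closes w hw

/-- THE NECESSARY AFFINE RUNG: the generic light law for AFFINE (degree-`≤ 1`) strategies — implied by the quadratic leaf, no numerics
exist for it (every census light instance so far is covariant), and by §2–§3 it is already immune to XOR / sparse certificates. -/
def AffineLightFail (w : ℕ) : Prop := GenericLightFail 1 w

/-- the quadratic (any `D ≥ 1`) generic leaf implies the affine rung. -/
theorem affineLightFail_of_generic {D w : ℕ} (hD : 1 ≤ D) (h : GenericLightFail D w) : AffineLightFail w :=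
  genericLightFail_anti_degree hD h

/-- the affine rung in dial form: `AffineLightFail w ⟺ LightFail 1 w` for `w ≥ 7`. -/
theorem affineLightFail_iff {w : ℕ} (hw : 7 ≤ w) : AffineLightFail w ↔ LightFail 1 w := (lightFail_iff_generic' hw).symm

/-! ## §5 What the barrier theorems say about the leaves (formal corollaries) -/

/-- THEOREM A against the generic classes: for `D ≥ 1` no weight vector on odd-class inputs of ONE length `n ≥ 3` is a XOR certificate of
failure for the degree-`≤ D` strategies — so neither `PGlobalFail`, `OGlobalFail` nor `AffineLightFail` can be proved, at any length, by
exhibiting a universal input (g26–g27's method for every special class) or a finite `𝔽₂`-combination of inputs. -/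
theorem no_xor_certificate (hn : 3 ≤ n) {D : ℕ} (hD : 1 ≤ D) (μ : BFn n) (hμ : ∀ x, μ x ≠ 0 → OddZeros x) (hne : μ ≠ 0) :
    ∃ P : Fin n → CubeFn (ZMod 3) n, (∀ i, P i ∈ lowDeg (ZMod 3) n D) ∧ ∑ x, μ x * win P x = ∑ x, μ x := by
  -- `Σ μ_x win = Σ μ_x` means: the μ-weighted LOSS parity is 0, i.e. the certificate `Σ μ_x loss_x = 1` fails for `P`
  exact winParity_attains hn hD μ hμ hne _

end Summit.QuantumAdvantage.QuantumAdvantage.Theorems.CertDial
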